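import Summits.BirchSwinnertonDyer.BirchSwinnertonDyer.Theorems.ErratumRoadFiveJSWSigmaLocalCharIdeal
import Summits.BirchSwinnertonDyer.BirchSwinnertonDyer.Theorems.ErratumRoadFiveIMCDivRoadFFFittingFrameBOfThm23
import HarnessLib

/-!
# Route `ErratumRoadFive` (rung K2, `p ≥ 5`): crux `IMCDivAtErratumDataAllR` (item stmt-BirchSwinnertonDyer-20169) and the parent
# `OpenInputIMC` (19061) BY NAME from the F-SPLIT facts — F4♯ (OPEN, ONE crystalline newform; [FW21 4.41]) + F3♯ (PUB member data) — and
# the route's PUBLISHED items: the certificate for a planner restate `CastellaErratumMemberPackage (20529) ↦ F4♯ (+ support F3♯)`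

Cell `bsd-stepL` (run/shared/lean/pub/bsd-stepL/), seat `bsd-stepL-imc-p1` (prover g15, 2026-08-28);
`--supports stmt-BirchSwinnertonDyer-20169 --as helper`. This module imports the route file (conclusions are route decls by name), so no
`_holds` link can be stated here. Design memo `HOME/imc-p1/g15/FSPLIT-DESIGN-20529-imc-p1-g15.md` (evidence on 20529).

## What this file proves and why it exists

* **`Theorems.imcDivAtErratumDataAllR_of_thm23_OPEN_of_frames`** — crux 20169 ⟸ F4♯
  (`Castella2018.erratumThm23_charIdeal_sigma_le_of_isTorsion_OPEN`, p590900) + F3♯ (`Castella2018.erratum_exists_frames_members_sigma_congruence`,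
  p591182) + JSW17 Thm. 3.3.1-mult (item 19626) + GZK + modularity, the local `Σ`-atom (20495) and Shapiro being THEOREMS — i.e. the
  composition `IMCDivAtErratumDataAllR_of` of the planned skeleton v5 {`stub_roadFF_thm23 := F4♯` (OPEN), `stub_roadFF_pubInputs := F3♯ ∧
  thm331_mult ∧ GZK ∧ nf`}; and `…_of_items` keyed to the route's support items 19626 ∕ 19283.
* **`Theorems.openInputIMC_of_thm23_OPEN_of_frames_of_rest3_of_notRam`** — the director's chain literally: «[FW21 4.41] fact (F4♯) → … →
  `P2OpenInputOnTreeAt`»: the parent 19061 ⟸ F4♯ + F3♯ + 19625 + 19283 + 19285 + 19626 + 19624 + 19282 (the twin of g15's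
  `openInputIMC_of_memberPackage_of_rest3_of_notRam`, p587378, with the member package O15 replaced by the split pair).
Compared with the route's present input O15 (K2 crux 20529 `CastellaErratumMemberPackage`), the OPEN content is now the ONE-NEWFORM
statement F4♯ (E-free, member-free, congruence-free — exactly the erratum's use of [FW21, Thm. 4.41]); the published ingredients of O15
moved to F3♯. Adopting it on the route (restate 20529, add F3♯ as support) is the planner's ∕ director's decision; this file is the
kernel certificate either way.

HONEST FRAMING: certificates «crux ⟸ named facts»; CONDITIONAL on F4♯ (OPEN, unrefereed) and the published facts; the crux is NOT proved;
the anticyclotomic main conjecture is asserted nowhere; BSD is proved for no pair; no census number moves (T7).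

References: [Castella2018Erratum] Thm. 2.3, (2.4)–(2.5), proof of Thm. 1.1 and footnote 1 (pp. 3–4); [FouquetWan2021] Thm. 4.41 (claim);
[Castella2020JIMJ] Thm. 2.11; [JetchevSkinnerWan2017] Thm. 3.3.1, §5.1; [SkinnerUrban2014] Prop. 3.2.3; cell files p587378, p588761, p589020,
p589525, p590900, p591182.
-/

set_option autoImplicit false
-- the Theorems namespace of this sub repeats the summit name by design (D-0017 nested layout)
set_option linter.dupNamespace false

noncomputable section

open scoped Classical
open WeierstrassCurve NumberField IsDedekindDomain
open Literature.NumberTheory.EllipticCurves Literature.NumberTheory.EllipticCurves.ModularForms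
  Literature.NumberTheory.EllipticCurves.Rank1Residual Literature.NumberTheory.EllipticCurves.JetchevSkinnerWan2017
  Literature.NumberTheory.EllipticCurves.Castella2018
open Summit.BirchSwinnertonDyer.Rank1Residual.X11b
open Summit.BirchSwinnertonDyer.BirchSwinnertonDyer.Theses.ErratumRoadFive

namespace Summit.BirchSwinnertonDyer.BirchSwinnertonDyer.Theorems

/-- **Crux 20169 `IMCDivAtErratumDataAllR` BY NAME from F4♯ (OPEN, one newform) + F3♯ (PUB member data) + JSW17 Thm. 3.3.1-mult + GZK +
modularity** — Σ-data by `P2.RoadFF.sigmaDataAtErratumDataB_of_sigmaLocal_of_prop323_of_thm331` (local atom + Shapiro, theorems), Fitting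
frame by `P2.RoadFF.fittingCongruenceFrameAtErratumDataB_of_thm23_OPEN_of_frames`, cut `P2.imcDivIntCoreFrameAtErratumDataB_of_roadFF_fitting`.
CONDITIONAL on the named inputs (F4♯ OPEN, unrefereed); nothing booked.
[claim: Castella2018Erratum, status: under-review] [claim: FouquetWan2021, status: under-review]
[cite: Castella2018Erratum, Thm. 2.3, (2.4)–(2.5) and proof of Thm. 1.1 (pp. 3–4)] [cite: Castella2020JIMJ, Thm. 2.11]
[cite: JetchevSkinnerWan2017, Thm. 3.3.1 with §3.5 (3.5.c); §5.1] -/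
theorem imcDivAtErratumDataAllR_of_thm23_OPEN_of_frames (h23 : erratumThm23_charIdeal_sigma_le_of_isTorsion_OPEN)
    (hL : erratum_exists_frames_members_sigma_congruence) (h331 : thm331_anticyclotomicControl_mult)
    (hGZK : rank_eq_analyticRank_of_analyticRank_le_one) (hnf : exists_isNewformOf) : IMCDivAtErratumDataAllR :=
  fun W _ _ p _ ↦
    P2.imcDivIntCoreFrameAtErratumDataB_of_roadFF_fitting
      (P2.RoadFF.sigmaDataAtErratumDataB_of_sigmaLocal_of_prop323_of_thm331 W p
        sigmaLocal_charIdeal_eulerFactor_mem_of_noTamagawaDefect_proved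
        SkinnerUrban2014.prop323_XAc_equiv_XBigDecomp_holds h331 hGZK hnf)
      (P2.RoadFF.fittingCongruenceFrameAtErratumDataB_of_thm23_OPEN_of_frames h23 hL W p)

/-- **Crux 20169 BY NAME from F4♯ + F3♯ + two ITEMS of the route** (19626 `JSWAnticyclotomicControlMult`; GZK = conjunct 2 and modularity
= conjunct 4 of 19283 `PublishedInputsIMCReduction`). CONDITIONAL; nothing booked.
[claim: Castella2018Erratum, status: under-review] [claim: FouquetWan2021, status: under-review]
[cite: Castella2018Erratum, Thm. 2.3 and proof of Thm. 1.1 (pp. 3–4)] [cite: JetchevSkinnerWan2017, Thm. 3.3.1] -/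
theorem imcDivAtErratumDataAllR_of_thm23_OPEN_of_frames_of_items (h23 : erratumThm23_charIdeal_sigma_le_of_isTorsion_OPEN)
    (hL : erratum_exists_frames_members_sigma_congruence) (h331 : JSWAnticyclotomicControlMult)
    (hF : PublishedInputsIMCReduction) : IMCDivAtErratumDataAllR :=
  imcDivAtErratumDataAllR_of_thm23_OPEN_of_frames h23 hL h331 hF.2.1 hF.2.2.2.1

/-- **The parent 19061 `OpenInputIMC` BY NAME from F4♯ + F3♯ + six ITEMS of the route** (19625, 19283, 19285, 19626, 19624, 19282):
«[FW21 4.41]-corollary for ONE newform (F4♯) → published member data (F3♯) → … → `P2OpenInputOnTreeAt` at every X11b pair `p ≥ 5`»,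
modulo the residual cruxes REST‴ ∕ ¬ram — composition with bdp's `KernelFromPrintB.openInputIMCBody_of_print_of_coreB_of_rest3_of_notRam`.
CONDITIONAL; nothing booked; BSD is proved for no pair.
[claim: Castella2018Erratum, status: under-review] [claim: FouquetWan2021, status: under-review]
[cite: Castella2018Erratum, Thm. 1.1, Thm. 2.3 and proof (pp. 1–4)] [cite: Castella2018Exceptional, Thms. 2.10–2.11]
[cite: Wuthrich2014, Prop. 21] [cite: JetchevSkinnerWan2017, Thm. 3.3.1 with §3.5 (3.5.c)] -/
theorem openInputIMC_of_thm23_OPEN_of_frames_of_rest3_of_notRam (h23 : erratumThm23_charIdeal_sigma_le_of_isTorsion_OPEN)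
    (hL : erratum_exists_frames_members_sigma_congruence) (hVN : BDPValueContinuityInput) (hF : PublishedInputsIMCReduction)
    (hWu : WuthrichShaDividesAnalyticSha) (h331 : JSWAnticyclotomicControlMult) (hrest : RamNoErratumDataAtFive)
    (hOff : OpenInputNotRam) : OpenInputIMC := by
  intro W _ _ p _
  exact KernelFromPrintB.openInputIMCBody_of_print_of_coreB_of_rest3_of_notRam hVN
    (imcDivAtErratumDataAllR_of_thm23_OPEN_of_frames_of_items h23 hL h331 hF) hF hWu h331 hrest hOff W p

end Summit.BirchSwinnertonDyer.BirchSwinnertonDyer.Theorems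

end
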